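import Literature.MathematicalPhysics.QuantumFieldTheory.Balaban1983to89.B1Eq324BenfattoSect5LedgerDischarge
import HarnessLib

/-!
# `Balaban1983to89.B1Eq324BenfattoSect5LedgerDischargeCumulant` — [BenfattoEtAl1978] p. 152 (4.6)–(4.7), p. 159 «Collecting all the errors made in this
# process»: THE LEDGER DISCHARGE, MODULE 2 — the closed CUMULANT SIDE of one pavement step (`…Sect5StepBound.exists_lower_step` / `exists_upper_step`,
# byte-identical in both) and the STRUCTURAL per-step errors `e₅₁₁`, `e₅₃₄`, absorbed ATOM BY ATOM into `|I|·errTerm S ρ₁ ρ₂ ρ₃ ρ₄ A b t` in both regimes — PROVED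

statement-level skeleton of published theorems with citation tags; proofs where landed; nothing here is a claim about the
Yang–Mills mass gap

WHY THIS MODULE (cell `pub-ymgap`, seat `dag-n08-b` gen 6; node N08 [Balaban1985UV3]; sequel of `…Sect5LedgerDischarge` (module 1: shapes, parameters,
normal forms, the per-box `ErrPB` atoms)).  The assembler's `ineq47_of_chain` / `ineq46_of_chain` carry, per step `k < d + 1`, the structural errors
`s₁Ab_k^De^{−(ϰ/4)w}|J_k| + s₁Ab_k^D(e^{−(ϰ/4)w}|Γ̄₁(B_k)| + e^{−(ϰ/4)v}|B_k|L^d)` and an `idErr k` which `…StepBound.exists_lower_step` closes as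
`Σ_□Err(□) + Σ_{k<t}(T_a + T_b + T_c + T_d + T_e + T_f)/(k+1)!` with six displayed terms: (a) the `(5.11)`-type removal `|Ê₀^T(H_J) − Ê₀^T(X)|`
(count `|J_k|`, decay `e^{−(ϰ′/2)w}`), (b) = (d) the `(5.34)`-type removals (count `|B_k|·L^d`, decay `e^{−(ϰ′/2)v}`), (c) the same for `H_{Γ̄₁}` (count
`|Γ̄₁(B_k)|`), (e) CROSS (count `|B_k|`, decay `e^{−(δ/(4(k+1)))(w+v+1)}`, the sibling `abs_cross_le_closed` at the assembler's palette), (f) `W₂₉` (count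
`|B_k|`, decay `e^{−(δ/2)(v+1)}`), `ϰ′ = ϰ/2 − (δ/2)D²√d`.  Each is here bounded by `nI·errTerm S_atom ρ₁ ρ₂ ρ₃ ρ₄ A b t` (through the second summand) with `S_atom` CLOSED and free of
`s, b, A, L, w, v, |I|` (uniform in `s` by module 1's `sum_adm_geom_nonneg_le`), in BOTH regimes of module 1 (`b₀ ≤ b → M·b^{3/2} ≤ v ≤ w`; bounded
regime absorbed by `b₀`), the counts entering as a generic real `N` with `N ≤ nI` resp. `N ≤ nI·L^d` and `freeCov d α β 0 0` as a generic `C₀₀` so that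
the assembler's instantiation (counts replaced by `|I|`-multiples or not) unifies by `exact`.

WHAT IS PROVED (theorems only; no definition, no named fact, no `sorry`; axioms standard).
* §5 ★ `cum_a_le`, ★ `cum_b_le` (serves (b) and (d)), ★ `cum_c_le`, ★★ `cum_e_le` (CROSS; multiplicity `k − 1 + 2`, no case split at `k = 0`), ★ `cum_f_le`.
* §6 `struct₁_le` (`e₅₁₁`), `struct₂_le` (`e₅₃₄`, both pieces at rate `ϰ/4`, `X = v ≤ w`).
The Appendix-A term is module 0's `…ErrTermLedger.appendixA_term_le_snd` at `γ′ = γ^{d+1}`; the remainder/volume/`εK^k`/`cχ`/`δ₂₉`/`δ₃₁` atoms of the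
per-box `Err` are module 1's `errPB_*`.

HONEST SCOPE / NOT HERE.  Real inequalities between displayed closed terms; no measure theory; the SUM over the `d+1` steps against the assembler's
`…LowerAssembly.ineq47_of_ledger` hypothesis (module 3), `basicLemma_consts`, `BasicLemma`/`BasicLemmaPrinted` are NOT here; count-neutral for N08;
nothing of [Balaban1985UV3] (41)/(47)/(5) is asserted; nothing about d = 4, the continuum, OS axioms, a mass gap or the Clay problem.
-/

noncomputable section

open Finset
open scoped BigOperators Nat

namespace Literature.MathematicalPhysics.QuantumFieldTheory.Balaban1983to89.B1Eq324BenfattoSect5LedgerDischargeCumulant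

open Literature.MathematicalPhysics.QuantumFieldTheory.Balaban1983to89.B1Eq324BenfattoLemma
open Literature.MathematicalPhysics.QuantumFieldTheory.Balaban1983to89.B1Eq324BenfattoSect5ErrTermLedger
open Literature.MathematicalPhysics.QuantumFieldTheory.Balaban1983to89.B1Eq324BenfattoSect5Eq511 (decayConst s1Const)
open Literature.MathematicalPhysics.QuantumFieldTheory.Balaban1983to89.B1Eq324BenfattoSect5LedgerDischarge

/-! ## §5  The closed cumulant side of `…Sect5StepBound.exists_lower_step` / `exists_upper_step` (byte-identical in both), atom by atom -/

section CumulantAtoms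

variable {s D d t : ℕ} {κ A b δ ρ₁ ρ₂ ρ₃ ρ₄ b₀ M N nI C00 : ℝ} {L w v : ℕ}

/-- The geometric factor `2/(1 − e^{−x})·e^{x}` is `≥ 0` for `x ≥ 0`. [folklore] -/
private theorem geom_nonneg' {x : ℝ} (hx : 0 ≤ x) : 0 ≤ 2 / (1 - Real.exp (-x)) * Real.exp x := by
  refine mul_nonneg (div_nonneg (by norm_num) ?_) (Real.exp_pos _).le
  have : Real.exp (-x) ≤ 1 := Real.exp_le_one_iff.mpr (by linarith)
  linarith

set_option maxHeartbeats 400000 in -- long `calc`/closed-term elaboration (ops-buildfix 2026-08-27: keep ≥ 2× headroom)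
/-- **ATOM (a) — the `|Ê₀^T(H_J) − Ê₀^T(X)|` term of the closed cumulant side: `2^{k+1}Φ·(A·E·e^{−(ϰ′/2)w}·N·Σ_w)·(A·E·g·Σ₁)^k`,
`N ≤ nI` (print: `N = |J_k| ≤ |I|`), fits the SECOND summand in both regimes** (rate `ϰ′/2`, `ϰ′ = ϰ/2 − (δ/2)D²√d ≥ 0`; wide corridors
`b₀ ≤ b → M·b^{3/2} ≤ w`; `ρ₃ + 1 ≤ (ϰ′/2)·M`): `≤ nI·(C·(k+1)!·(0! + b₀⁰e^{ρ₃b₀^{3/2}}))·e^{−ρ₃b^{3/2}}e^{ρ₄Ab^{ρ₃}}`, `C` closed and `s`-free.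
[cite: BenfattoEtAl1978, (5.11) p.155, (5.35) p.159, Appendix D p.165, (4.7) p.152] -/
theorem cum_a_le (hA : 0 ≤ A) (hb : 1 ≤ b) (hL : ((L : ℕ) : ℝ) ≤ 2 * b ^ 2) (hδ : 0 ≤ δ) (hκ' : 0 ≤ κ / 2 - δ / 2 * ((D : ℝ) ^ 2 * Real.sqrt d))
    (hb₀ : 0 ≤ b₀) (hρ₃ : 0 ≤ ρ₃) (hρ₄ : 1 ≤ ρ₄) (hN0 : 0 ≤ N) (hNle : N ≤ nI)
    (hreg : b₀ ≤ b → M * b ^ (3 / 2 : ℝ) ≤ (w : ℝ)) (hM : ρ₃ + 1 ≤ (κ / 2 - δ / 2 * ((D : ℝ) ^ 2 * Real.sqrt d)) / 2 * M) (k : ℕ) :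
    (2 ^ (k + 1) * (2 ^ ((k + 1) * D) * 2 ^ 2 ^ ((k + 1) * D) * (max 1 C00) ^ ((k + 1) * D))) * ((A * Real.exp (δ / 2 * ((D : ℝ) ^ 2 * d)) * Real.exp (-((κ / 2 - δ / 2 * ((D : ℝ) ^ 2 * Real.sqrt d)) / 2 * w))) * N * ∑ p ∈ Finset.Icc 1 s, ((admissible p D).card : ℝ) * ((2 / (1 - Real.exp (-((κ / 2 - δ / 2 * ((D : ℝ) ^ 2 * Real.sqrt d)) / 2 / (p : ℕ) / Real.sqrt d))) * Real.exp ((κ / 2 - δ / 2 * ((D : ℝ) ^ 2 * Real.sqrt d)) / 2 / (p : ℕ) / Real.sqrt d)) ^ d) ^ (p - 1)) * (A * Real.exp (δ / 2 * ((D : ℝ) ^ 2 * d)) * ((1 : ℝ) * (2 / (1 - Real.exp (-(δ / (2 * ((k + 1 : ℕ) : ℝ)) / Real.sqrt d))) * Real.exp (δ / (2 * ((k + 1 : ℕ) : ℝ)) / Real.sqrt d)) ^ d) * ∑ p ∈ Finset.Icc 1 s, ((admissible p D).card : ℝ) * ((2 / (1 - Real.exp (-((κ / 2 - δ / 2 *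 ((D : ℝ) ^ 2 * Real.sqrt d)) / (p : ℕ) / Real.sqrt d))) * Real.exp ((κ / 2 - δ / 2 * ((D : ℝ) ^ 2 * Real.sqrt d)) / (p : ℕ) / Real.sqrt d)) ^ d) ^ (p - 1)) ^ k ≤
      nI * errTerm ((2 ^ (k + 1) * (2 ^ ((k + 1) * D) * 2 ^ 2 ^ ((k + 1) * D) * (max 1 C00) ^ ((k + 1) * D)) * (Real.exp (δ / 2 * ((D : ℝ) ^ 2 * d)) * ∑ p ∈ Finset.Icc 1 D, ((admissible p D).card : ℝ) * ((2 / (1 - Real.exp (-((κ / 2 - δ / 2 * ((D : ℝ) ^ 2 * Real.sqrt d)) / 2 / (p : ℕ) / Real.sqrt d))) * Real.exp ((κ / 2 - δ / 2 * ((D : ℝ) ^ 2 * Real.sqrt d)) / 2 / (p : ℕ) / Real.sqrt d)) ^ d) ^ (p - 1)) * (Real.exp (δ / 2 * ((D : ℝ) ^ 2 * d)) * ((1 : ℝ) * (2 / (1 - Real.exp (-(δ / (2 * ((k + 1 : ℕ) : ℝ)) / Real.sqrt d))) * Real.exp (δ / (2 * ((k + 1 : ℕ) : ℝ)) / Real.sqrt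 d)) ^ d) * ∑ p ∈ Finset.Icc 1 D, ((admissible p D).card : ℝ) * ((2 / (1 - Real.exp (-((κ / 2 - δ / 2 * ((D : ℝ) ^ 2 * Real.sqrt d)) / (p : ℕ) / Real.sqrt d))) * Real.exp ((κ / 2 - δ / 2 * ((D : ℝ) ^ 2 * Real.sqrt d)) / (p : ℕ) / Real.sqrt d)) ^ d) ^ (p - 1)) ^ k) * (k + 1).factorial * ((0).factorial + b₀ ^ (0) * Real.exp (ρ₃ * b₀ ^ (3 / 2 : ℝ)))) ρ₁ ρ₂ ρ₃ ρ₄ A b t := by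
  have hb0 : 0 ≤ b := zero_le_one.trans hb
  have hm0 : (0 : ℝ) ≤ max 1 C00 := le_max_of_le_left zero_le_one
  have hκ'2 : 0 ≤ (κ / 2 - δ / 2 * ((D : ℝ) ^ 2 * Real.sqrt d)) / 2 := by linarith
  obtain ⟨hSw0, hSwle⟩ := sum_adm_geom_nonneg_le hκ'2 s D d
  obtain ⟨hSwD0, -⟩ := sum_adm_geom_nonneg_le hκ'2 D D d
  obtain ⟨hS10, hS1le⟩ := sum_adm_geom_nonneg_le hκ' s D d
  obtain ⟨hS1D0, -⟩ := sum_adm_geom_nonneg_le hκ' D D d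
  set Sws := ∑ p ∈ Finset.Icc 1 s, ((admissible p D).card : ℝ) * ((2 / (1 - Real.exp (-((κ / 2 - δ / 2 * ((D : ℝ) ^ 2 * Real.sqrt d)) / 2 / (p : ℕ) / Real.sqrt d))) * Real.exp ((κ / 2 - δ / 2 * ((D : ℝ) ^ 2 * Real.sqrt d)) / 2 / (p : ℕ) / Real.sqrt d)) ^ d) ^ (p - 1) with hSws
  set SwD := ∑ p ∈ Finset.Icc 1 D, ((admissible p D).card : ℝ) * ((2 / (1 - Real.exp (-((κ / 2 - δ / 2 * ((D : ℝ) ^ 2 * Real.sqrt d)) / 2 / (p : ℕ) / Real.sqrt d))) * Real.exp ((κ / 2 - δ / 2 * ((D : ℝ) ^ 2 * Real.sqrt d)) / 2 / (p : ℕ) / Real.sqrt d)) ^ d) ^ (p - 1) with hSwD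
  clear_value Sws SwD
  set S1s := ∑ p ∈ Finset.Icc 1 s, ((admissible p D).card : ℝ) * ((2 / (1 - Real.exp (-((κ / 2 - δ / 2 * ((D : ℝ) ^ 2 * Real.sqrt d)) / (p : ℕ) / Real.sqrt d))) * Real.exp ((κ / 2 - δ / 2 * ((D : ℝ) ^ 2 * Real.sqrt d)) / (p : ℕ) / Real.sqrt d)) ^ d) ^ (p - 1) with hS1s
  set S1D := ∑ p ∈ Finset.Icc 1 D, ((admissible p D).card : ℝ) * ((2 / (1 - Real.exp (-((κ / 2 - δ / 2 * ((D : ℝ) ^ 2 * Real.sqrt d)) / (p : ℕ) / Real.sqrt d))) * Real.exp ((κ / 2 - δ / 2 * ((D : ℝ) ^ 2 * Real.sqrt d)) / (p : ℕ) / Real.sqrt d)) ^ d) ^ (p - 1) with hS1D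
  clear_value S1s S1D
  set Φ : ℝ := 2 ^ ((k + 1) * D) * 2 ^ 2 ^ ((k + 1) * D) * (max 1 C00) ^ ((k + 1) * D) with hΦ
  have hΦ0 : 0 ≤ Φ := by rw [hΦ]; positivity
  clear_value Φ
  set E : ℝ := Real.exp (δ / 2 * ((D : ℝ) ^ 2 * d)) with hE
  have hE0 : 0 ≤ E := by rw [hE]; exact (Real.exp_pos _).le
  clear_value E
  set g : ℝ := (2 / (1 - Real.exp (-(δ / (2 * ((k + 1 : ℕ) : ℝ)) / Real.sqrt d))) * Real.exp (δ / (2 * ((k + 1 : ℕ) : ℝ)) / Real.sqrt d)) ^ d with hg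
  have hg0 : 0 ≤ g := by rw [hg]; exact pow_nonneg (geom_nonneg' (by positivity)) d
  clear_value g
  have hLd := side_pow_le hL d
  have hLd0 : 0 ≤ ((L : ℕ) : ℝ) ^ d := by positivity
  have hc0 : 0 ≤ (κ / 2 - δ / 2 * ((D : ℝ) ^ 2 * Real.sqrt d)) / 2 := hκ'2
  have hX0 : (0 : ℝ) ≤ (w : ℝ) := Nat.cast_nonneg w
  have h1 : (A * E * ((1 : ℝ) * g) * S1s) ^ k ≤ (A * E * ((1 : ℝ) * g) * S1D) ^ k := pow_le_pow_left₀ (by positivity) (by gcongr) k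
  have hnI' : 0 ≤ nI := hN0.trans hNle
  have hkey : (2 ^ (k + 1) * (Φ)) * ((A * E * Real.exp (-((κ / 2 - δ / 2 * ((D : ℝ) ^ 2 * Real.sqrt d)) / 2 * w))) * N * Sws) * (A * E * ((1 : ℝ) * g) * S1s) ^ k ≤
      ((2 ^ (k + 1) * (Φ) * (E * SwD) * (E * ((1 : ℝ) * g) * S1D) ^ k) * b ^ (0) * A ^ (k + 1) * Real.exp (-((κ / 2 - δ / 2 * ((D : ℝ) ^ 2 * Real.sqrt d)) / 2 * ((w : ℝ))))) * N := by
    calc (2 ^ (k + 1) * (Φ)) * ((A * E * Real.exp (-((κ / 2 - δ / 2 * ((D : ℝ) ^ 2 * Real.sqrt d)) / 2 * w))) * N * Sws) * (A * E * ((1 : ℝ) * g) * S1s) ^ k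
        ≤ (2 ^ (k + 1) * Φ) * ((A * E * Real.exp (-((κ / 2 - δ / 2 * ((D : ℝ) ^ 2 * Real.sqrt d)) / 2 * w))) * N * SwD) * (A * E * ((1 : ℝ) * g) * S1D) ^ k := by gcongr
      _ = _ := by ring
  have hatom := decay_atom_le_snd (A := A) (b := b) (b₀ := b₀) (ρ₃ := ρ₃) (ρ₄ := ρ₄)
    (C := 2 ^ (k + 1) * (Φ) * (E * SwD) * (E * ((1 : ℝ) * g) * S1D) ^ k) (c := (κ / 2 - δ / 2 * ((D : ℝ) ^ 2 * Real.sqrt d)) / 2) (X := (w : ℝ)) (M := M)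
    (by positivity) hA hb hb₀ hρ₃ hρ₄ hc0 hX0 hreg hM (0) (k + 1)
  have hS0' : 0 ≤ (2 ^ (k + 1) * (Φ) * (E * SwD) * (E * ((1 : ℝ) * g) * S1D) ^ k) * (k + 1).factorial * ((0).factorial + b₀ ^ (0) * Real.exp (ρ₃ * b₀ ^ (3 / 2 : ℝ))) := by positivity
  have hS0 : 0 ≤ (2 ^ (k + 1) * (Φ) * (E * SwD) * (E * ((1 : ℝ) * g) * S1D) ^ k) * (k + 1).factorial * ((0).factorial + b₀ ^ (0) * Real.exp (ρ₃ * b₀ ^ (3 / 2 : ℝ))) * (Real.exp (-(ρ₃ * b ^ (3 / 2 : ℝ))) * Real.exp (ρ₄ * A * b ^ ρ₃)) := by positivity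
  have hfin := le_errTerm_of_le_snd (ρ₁ := ρ₁) (ρ₂ := ρ₂) (t := t) (le_refl ((2 ^ (k + 1) * (Φ) * (E * SwD) * (E * ((1 : ℝ) * g) * S1D) ^ k) * (k + 1).factorial * ((0).factorial + b₀ ^ (0) * Real.exp (ρ₃ * b₀ ^ (3 / 2 : ℝ))) * (Real.exp (-(ρ₃ * b ^ (3 / 2 : ℝ))) * Real.exp (ρ₄ * A * b ^ ρ₃)))) hS0' hA hb0
  calc (2 ^ (k + 1) * (Φ)) * ((A * E * Real.exp (-((κ / 2 - δ / 2 * ((D : ℝ) ^ 2 * Real.sqrt d)) / 2 * w))) * N * Sws) * (A * E * ((1 : ℝ) * g) * S1s) ^ k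
      ≤ ((2 ^ (k + 1) * (Φ) * (E * SwD) * (E * ((1 : ℝ) * g) * S1D) ^ k) * b ^ (0) * A ^ (k + 1) * Real.exp (-((κ / 2 - δ / 2 * ((D : ℝ) ^ 2 * Real.sqrt d)) / 2 * ((w : ℝ))))) * N := hkey
    _ ≤ ((2 ^ (k + 1) * (Φ) * (E * SwD) * (E * ((1 : ℝ) * g) * S1D) ^ k) * (k + 1).factorial * ((0).factorial + b₀ ^ (0) * Real.exp (ρ₃ * b₀ ^ (3 / 2 : ℝ))) * (Real.exp (-(ρ₃ * b ^ (3 / 2 : ℝ))) * Real.exp (ρ₄ * A * b ^ ρ₃))) * nI := mul_le_mul hatom hNle hN0 hS0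
    _ = nI * ((2 ^ (k + 1) * (Φ) * (E * SwD) * (E * ((1 : ℝ) * g) * S1D) ^ k) * (k + 1).factorial * ((0).factorial + b₀ ^ (0) * Real.exp (ρ₃ * b₀ ^ (3 / 2 : ℝ))) * (Real.exp (-(ρ₃ * b ^ (3 / 2 : ℝ))) * Real.exp (ρ₄ * A * b ^ ρ₃))) := by ring
    _ ≤ _ := mul_le_mul_of_nonneg_left hfin hnI'

set_option maxHeartbeats 400000 in -- long `calc`/closed-term elaboration (ops-buildfix 2026-08-27: keep ≥ 2× headroom)
/-- **ATOM (b) = (d) — the (5.34)-type term `2^{k+1}Φ·(N·A·E·e^{−(ϰ′/2)v}·L^d·Σ_w)·(A·E·g·Σ₁)^k` (print: `N = |B_k| ≤ |I|`) fits the SECOND summand in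
both regimes** (rate `ϰ′/2`, `X = v`): `≤ nI·(C·(k+1)!·((2d)! + b₀^{2d}e^{ρ₃b₀^{3/2}}))·e^{−ρ₃b^{3/2}}e^{ρ₄Ab^{ρ₃}}`.
[cite: BenfattoEtAl1978, (5.34) p.159, (5.35) p.159, Appendix D p.165, (4.7) p.152] -/
theorem cum_b_le (hA : 0 ≤ A) (hb : 1 ≤ b) (hL : ((L : ℕ) : ℝ) ≤ 2 * b ^ 2) (hδ : 0 ≤ δ) (hκ' : 0 ≤ κ / 2 - δ / 2 * ((D : ℝ) ^ 2 * Real.sqrt d))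
    (hb₀ : 0 ≤ b₀) (hρ₃ : 0 ≤ ρ₃) (hρ₄ : 1 ≤ ρ₄) (hN0 : 0 ≤ N) (hNle : N ≤ nI)
    (hreg : b₀ ≤ b → M * b ^ (3 / 2 : ℝ) ≤ (v : ℝ)) (hM : ρ₃ + 1 ≤ (κ / 2 - δ / 2 * ((D : ℝ) ^ 2 * Real.sqrt d)) / 2 * M) (k : ℕ) :
    2 ^ (k + 1) * (2 ^ ((k + 1) * D) * 2 ^ 2 ^ ((k + 1) * D) * (max 1 C00) ^ ((k + 1) * D)) * (N * (A * Real.exp (δ / 2 * ((D : ℝ) ^ 2 * d)) * Real.exp (-((κ / 2 - δ / 2 * ((D : ℝ) ^ 2 * Real.sqrt d)) / 2 * v))) * ((L : ℕ) : ℝ) ^ d * ∑ p ∈ Finset.Icc 1 s, ((admissible p D).card : ℝ) * ((2 / (1 - Real.exp (-((κ / 2 - δ / 2 * ((D : ℝ) ^ 2 * Real.sqrt d)) / 2 / (p : ℕ) / Real.sqrt d))) * Real.exp ((κ / 2 - δ / 2 * ((D : ℝ) ^ 2 * Real.sqrt d)) / 2 / (p : ℕ) / Real.sqrt d)) ^ d)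 ^ (p - 1)) * (A * Real.exp (δ / 2 * ((D : ℝ) ^ 2 * d)) * (2 / (1 - Real.exp (-(δ / (2 * ((k + 1 : ℕ) : ℝ)) / Real.sqrt d))) * Real.exp (δ / (2 * ((k + 1 : ℕ) : ℝ)) / Real.sqrt d)) ^ d * ∑ p ∈ Finset.Icc 1 s, ((admissible p D).card : ℝ) * ((2 / (1 - Real.exp (-((κ / 2 - δ / 2 * ((D : ℝ) ^ 2 * Real.sqrt d)) / (p : ℕ) / Real.sqrt d))) * Real.exp ((κ / 2 - δ / 2 * ((D : ℝ) ^ 2 * Real.sqrt d)) / (p : ℕ) / Real.sqrt d)) ^ d) ^ (p - 1)) ^ k ≤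
      nI * errTerm ((2 ^ (k + 1) * (2 ^ ((k + 1) * D) * 2 ^ 2 ^ ((k + 1) * D) * (max 1 C00) ^ ((k + 1) * D)) * (Real.exp (δ / 2 * ((D : ℝ) ^ 2 * d)) * 2 ^ d * ∑ p ∈ Finset.Icc 1 D, ((admissible p D).card : ℝ) * ((2 / (1 - Real.exp (-((κ / 2 - δ / 2 * ((D : ℝ) ^ 2 * Real.sqrt d)) / 2 / (p : ℕ) / Real.sqrt d))) * Real.exp ((κ / 2 - δ / 2 * ((D : ℝ) ^ 2 * Real.sqrt d)) / 2 / (p : ℕ) / Real.sqrt d)) ^ d) ^ (p - 1)) * (Real.exp (δ / 2 * ((D : ℝ) ^ 2 * d)) * (2 / (1 - Real.exp (-(δ / (2 * ((k + 1 : ℕ) : ℝ)) / Real.sqrt d))) * Real.exp (δ / (2 * ((k + 1 : ℕ) : ℝ)) / Real.sqrt d)) ^ d * ∑ p ∈ Finset.Icc 1 D, ((admissible p D).card : ℝ) * ((2 / (1 - Real.exp (-((κ / 2 - δ / 2 * ((D : ℝ) ^ 2 * Real.sqrt d)) / (p : ℕ) / Real.sqrt d))) * Real.exp ((κ / 2 -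 δ / 2 * ((D : ℝ) ^ 2 * Real.sqrt d)) / (p : ℕ) / Real.sqrt d)) ^ d) ^ (p - 1)) ^ k) * (k + 1).factorial * ((2 * d).factorial + b₀ ^ (2 * d) * Real.exp (ρ₃ * b₀ ^ (3 / 2 : ℝ)))) ρ₁ ρ₂ ρ₃ ρ₄ A b t := by
  have hb0 : 0 ≤ b := zero_le_one.trans hb
  have hm0 : (0 : ℝ) ≤ max 1 C00 := le_max_of_le_left zero_le_one
  have hκ'2 : 0 ≤ (κ / 2 - δ / 2 * ((D : ℝ) ^ 2 * Real.sqrt d)) / 2 := by linarith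
  obtain ⟨hSw0, hSwle⟩ := sum_adm_geom_nonneg_le hκ'2 s D d
  obtain ⟨hSwD0, -⟩ := sum_adm_geom_nonneg_le hκ'2 D D d
  obtain ⟨hS10, hS1le⟩ := sum_adm_geom_nonneg_le hκ' s D d
  obtain ⟨hS1D0, -⟩ := sum_adm_geom_nonneg_le hκ' D D d
  set Sws := ∑ p ∈ Finset.Icc 1 s, ((admissible p D).card : ℝ) * ((2 / (1 - Real.exp (-((κ / 2 - δ / 2 * ((D : ℝ) ^ 2 * Real.sqrt d)) / 2 / (p : ℕ) / Real.sqrt d))) * Real.exp ((κ / 2 - δ / 2 * ((D : ℝ) ^ 2 * Real.sqrt d)) / 2 / (p : ℕ) / Real.sqrt d)) ^ d) ^ (p - 1) with hSws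
  set SwD := ∑ p ∈ Finset.Icc 1 D, ((admissible p D).card : ℝ) * ((2 / (1 - Real.exp (-((κ / 2 - δ / 2 * ((D : ℝ) ^ 2 * Real.sqrt d)) / 2 / (p : ℕ) / Real.sqrt d))) * Real.exp ((κ / 2 - δ / 2 * ((D : ℝ) ^ 2 * Real.sqrt d)) / 2 / (p : ℕ) / Real.sqrt d)) ^ d) ^ (p - 1) with hSwD
  clear_value Sws SwD
  set S1s := ∑ p ∈ Finset.Icc 1 s, ((admissible p D).card : ℝ) * ((2 / (1 - Real.exp (-((κ / 2 - δ / 2 * ((D : ℝ) ^ 2 * Real.sqrt d)) / (p : ℕ) / Real.sqrt d))) * Real.exp ((κ / 2 - δ / 2 * ((D : ℝ) ^ 2 * Real.sqrt d)) / (p : ℕ) / Real.sqrt d)) ^ d) ^ (p - 1) with hS1s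
  set S1D := ∑ p ∈ Finset.Icc 1 D, ((admissible p D).card : ℝ) * ((2 / (1 - Real.exp (-((κ / 2 - δ / 2 * ((D : ℝ) ^ 2 * Real.sqrt d)) / (p : ℕ) / Real.sqrt d))) * Real.exp ((κ / 2 - δ / 2 * ((D : ℝ) ^ 2 * Real.sqrt d)) / (p : ℕ) / Real.sqrt d)) ^ d) ^ (p - 1) with hS1D
  clear_value S1s S1D
  set Φ : ℝ := 2 ^ ((k + 1) * D) * 2 ^ 2 ^ ((k + 1) * D) * (max 1 C00) ^ ((k + 1) * D) with hΦ
  have hΦ0 : 0 ≤ Φ := by rw [hΦ]; positivity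
  clear_value Φ
  set E : ℝ := Real.exp (δ / 2 * ((D : ℝ) ^ 2 * d)) with hE
  have hE0 : 0 ≤ E := by rw [hE]; exact (Real.exp_pos _).le
  clear_value E
  set g : ℝ := (2 / (1 - Real.exp (-(δ / (2 * ((k + 1 : ℕ) : ℝ)) / Real.sqrt d))) * Real.exp (δ / (2 * ((k + 1 : ℕ) : ℝ)) / Real.sqrt d)) ^ d with hg
  have hg0 : 0 ≤ g := by rw [hg]; exact pow_nonneg (geom_nonneg' (by positivity)) d
  clear_value g
  have hLd := side_pow_le hL d
  have hLd0 : 0 ≤ ((L : ℕ) : ℝ) ^ d := by positivity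
  have hc0 : 0 ≤ (κ / 2 - δ / 2 * ((D : ℝ) ^ 2 * Real.sqrt d)) / 2 := hκ'2
  have hX0 : (0 : ℝ) ≤ (v : ℝ) := Nat.cast_nonneg v
  have h1 : (A * E * g * S1s) ^ k ≤ (A * E * g * S1D) ^ k := pow_le_pow_left₀ (by positivity) (by gcongr) k
  have hnI' : 0 ≤ nI := hN0.trans hNle
  have hkey : 2 ^ (k + 1) * (Φ) * (N * (A * E * Real.exp (-((κ / 2 - δ / 2 * ((D : ℝ) ^ 2 * Real.sqrt d)) / 2 * v))) * ((L : ℕ) : ℝ) ^ d * Sws) * (A * E * g * S1s) ^ k ≤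
      ((2 ^ (k + 1) * (Φ) * (E * 2 ^ d * SwD) * (E * g * S1D) ^ k) * b ^ (2 * d) * A ^ (k + 1) * Real.exp (-((κ / 2 - δ / 2 * ((D : ℝ) ^ 2 * Real.sqrt d)) / 2 * ((v : ℝ))))) * N := by
    calc 2 ^ (k + 1) * (Φ) * (N * (A * E * Real.exp (-((κ / 2 - δ / 2 * ((D : ℝ) ^ 2 * Real.sqrt d)) / 2 * v))) * ((L : ℕ) : ℝ) ^ d * Sws) * (A * E * g * S1s) ^ k
        ≤ 2 ^ (k + 1) * Φ * (N * (A * E * Real.exp (-((κ / 2 - δ / 2 * ((D : ℝ) ^ 2 * Real.sqrt d)) / 2 * v))) * (2 ^ d * b ^ (2 * d)) * SwD) * (A * E * g * S1D) ^ k := by gcongr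
      _ = _ := by ring
  have hatom := decay_atom_le_snd (A := A) (b := b) (b₀ := b₀) (ρ₃ := ρ₃) (ρ₄ := ρ₄)
    (C := 2 ^ (k + 1) * (Φ) * (E * 2 ^ d * SwD) * (E * g * S1D) ^ k) (c := (κ / 2 - δ / 2 * ((D : ℝ) ^ 2 * Real.sqrt d)) / 2) (X := (v : ℝ)) (M := M)
    (by positivity) hA hb hb₀ hρ₃ hρ₄ hc0 hX0 hreg hM (2 * d) (k + 1)
  have hS0' : 0 ≤ (2 ^ (k + 1) * (Φ) * (E * 2 ^ d * SwD) * (E * g * S1D) ^ k) * (k + 1).factorial * ((2 * d).factorial + b₀ ^ (2 * d) * Real.exp (ρ₃ * b₀ ^ (3 / 2 : ℝ))) := by positivity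
  have hS0 : 0 ≤ (2 ^ (k + 1) * (Φ) * (E * 2 ^ d * SwD) * (E * g * S1D) ^ k) * (k + 1).factorial * ((2 * d).factorial + b₀ ^ (2 * d) * Real.exp (ρ₃ * b₀ ^ (3 / 2 : ℝ))) * (Real.exp (-(ρ₃ * b ^ (3 / 2 : ℝ))) * Real.exp (ρ₄ * A * b ^ ρ₃)) := by positivity
  have hfin := le_errTerm_of_le_snd (ρ₁ := ρ₁) (ρ₂ := ρ₂) (t := t) (le_refl ((2 ^ (k + 1) * (Φ) * (E * 2 ^ d * SwD) * (E * g * S1D) ^ k) * (k + 1).factorial * ((2 * d).factorial + b₀ ^ (2 * d) * Real.exp (ρ₃ * b₀ ^ (3 / 2 : ℝ))) * (Real.exp (-(ρ₃ * b ^ (3 / 2 : ℝ))) * Real.exp (ρ₄ * A * b ^ ρ₃)))) hS0' hA hb0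
  calc 2 ^ (k + 1) * (Φ) * (N * (A * E * Real.exp (-((κ / 2 - δ / 2 * ((D : ℝ) ^ 2 * Real.sqrt d)) / 2 * v))) * ((L : ℕ) : ℝ) ^ d * Sws) * (A * E * g * S1s) ^ k
      ≤ ((2 ^ (k + 1) * (Φ) * (E * 2 ^ d * SwD) * (E * g * S1D) ^ k) * b ^ (2 * d) * A ^ (k + 1) * Real.exp (-((κ / 2 - δ / 2 * ((D : ℝ) ^ 2 * Real.sqrt d)) / 2 * ((v : ℝ))))) * N := hkey
    _ ≤ ((2 ^ (k + 1) * (Φ) * (E * 2 ^ d * SwD) * (E * g * S1D) ^ k) * (k + 1).factorial * ((2 * d).factorial + b₀ ^ (2 * d) * Real.exp (ρ₃ * b₀ ^ (3 / 2 : ℝ))) * (Real.exp (-(ρ₃ * b ^ (3 / 2 : ℝ))) * Real.exp (ρ₄ * A * b ^ ρ₃))) * nI := mul_le_mul hatom hNle hN0 hS0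
    _ = nI * ((2 ^ (k + 1) * (Φ) * (E * 2 ^ d * SwD) * (E * g * S1D) ^ k) * (k + 1).factorial * ((2 * d).factorial + b₀ ^ (2 * d) * Real.exp (ρ₃ * b₀ ^ (3 / 2 : ℝ))) * (Real.exp (-(ρ₃ * b ^ (3 / 2 : ℝ))) * Real.exp (ρ₄ * A * b ^ ρ₃))) := by ring
    _ ≤ _ := mul_le_mul_of_nonneg_left hfin hnI'

set_option maxHeartbeats 400000 in -- long `calc`/closed-term elaboration (ops-buildfix 2026-08-27: keep ≥ 2× headroom)
/-- **ATOM (c) — the `|Ê₀^T(H_{Γ̄₁}) − Ê₀^T(Y)|` term `2^{k+1}Φ·(A·E·e^{−(ϰ′/2)w}·N·Σ_w)·(A·E·g·Σ₁)^k` with `N ≤ nI·L^d` (print: `N = |Γ̄₁(B_k)| ≤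
|B_k|·L^d`) fits the SECOND summand in both regimes** (rate `ϰ′/2`, `X = w`): `≤ nI·(C·(k+1)!·((2d)! + b₀^{2d}e^{ρ₃b₀^{3/2}}))·e^{−ρ₃b^{3/2}}e^{ρ₄Ab^{ρ₃}}`.
[cite: BenfattoEtAl1978, (5.11) p.155, (5.35) p.159, Appendix D p.165, (4.7) p.152] -/
theorem cum_c_le (hA : 0 ≤ A) (hb : 1 ≤ b) (hL : ((L : ℕ) : ℝ) ≤ 2 * b ^ 2) (hδ : 0 ≤ δ) (hκ' : 0 ≤ κ / 2 - δ / 2 * ((D : ℝ) ^ 2 * Real.sqrt d))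
    (hb₀ : 0 ≤ b₀) (hρ₃ : 0 ≤ ρ₃) (hρ₄ : 1 ≤ ρ₄) (hnI : 0 ≤ nI) (hNle : N ≤ nI * ((L : ℕ) : ℝ) ^ d)
    (hreg : b₀ ≤ b → M * b ^ (3 / 2 : ℝ) ≤ (w : ℝ)) (hM : ρ₃ + 1 ≤ (κ / 2 - δ / 2 * ((D : ℝ) ^ 2 * Real.sqrt d)) / 2 * M) (k : ℕ) :
    (2 ^ (k + 1) * (2 ^ ((k + 1) * D) * 2 ^ 2 ^ ((k + 1) * D) * (max 1 C00) ^ ((k + 1) * D))) * (A * Real.exp (δ / 2 * ((D : ℝ) ^ 2 * d)) * Real.exp (-((κ / 2 - δ / 2 * ((D : ℝ) ^ 2 * Real.sqrt d)) / 2 * w)) * N * ∑ p ∈ Finset.Icc 1 s, ((admissible p D).card : ℝ) * ((2 / (1 - Real.exp (-((κ / 2 - δ / 2 * ((D : ℝ) ^ 2 * Real.sqrt d)) / 2 / (p : ℕ) / Real.sqrt d))) * Real.exp ((κ / 2 - δ / 2 * ((D : ℝ) ^ 2 * Real.sqrt d)) / 2 / (p : ℕ) / Real.sqrt d)) ^ d)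 ^ (p - 1)) * (A * Real.exp (δ / 2 * ((D : ℝ) ^ 2 * d)) * (2 / (1 - Real.exp (-(δ / (2 * ((k + 1 : ℕ) : ℝ)) / Real.sqrt d))) * Real.exp (δ / (2 * ((k + 1 : ℕ) : ℝ)) / Real.sqrt d)) ^ d * ∑ p ∈ Finset.Icc 1 s, ((admissible p D).card : ℝ) * ((2 / (1 - Real.exp (-((κ / 2 - δ / 2 * ((D : ℝ) ^ 2 * Real.sqrt d)) / (p : ℕ) / Real.sqrt d))) * Real.exp ((κ / 2 - δ / 2 * ((D : ℝ) ^ 2 * Real.sqrt d)) / (p : ℕ) / Real.sqrt d)) ^ d) ^ (p - 1)) ^ k ≤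
      nI * errTerm ((2 ^ (k + 1) * (2 ^ ((k + 1) * D) * 2 ^ 2 ^ ((k + 1) * D) * (max 1 C00) ^ ((k + 1) * D)) * (Real.exp (δ / 2 * ((D : ℝ) ^ 2 * d)) * 2 ^ d * ∑ p ∈ Finset.Icc 1 D, ((admissible p D).card : ℝ) * ((2 / (1 - Real.exp (-((κ / 2 - δ / 2 * ((D : ℝ) ^ 2 * Real.sqrt d)) / 2 / (p : ℕ) / Real.sqrt d))) * Real.exp ((κ / 2 - δ / 2 * ((D : ℝ) ^ 2 * Real.sqrt d)) / 2 / (p : ℕ) / Real.sqrt d)) ^ d) ^ (p - 1)) * (Real.exp (δ / 2 * ((D : ℝ) ^ 2 * d)) * (2 / (1 - Real.exp (-(δ / (2 * ((k + 1 : ℕ) : ℝ)) / Real.sqrt d))) * Real.exp (δ / (2 * ((k + 1 : ℕ) : ℝ)) / Real.sqrt d)) ^ d * ∑ p ∈ Finset.Icc 1 D, ((admissible p D).card : ℝ) * ((2 / (1 - Real.exp (-((κ / 2 - δ / 2 * ((D : ℝ) ^ 2 * Real.sqrt d)) / (p : ℕ) / Real.sqrt d))) * Real.exp ((κ / 2 -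 δ / 2 * ((D : ℝ) ^ 2 * Real.sqrt d)) / (p : ℕ) / Real.sqrt d)) ^ d) ^ (p - 1)) ^ k) * (k + 1).factorial * ((2 * d).factorial + b₀ ^ (2 * d) * Real.exp (ρ₃ * b₀ ^ (3 / 2 : ℝ)))) ρ₁ ρ₂ ρ₃ ρ₄ A b t := by
  have hb0 : 0 ≤ b := zero_le_one.trans hb
  have hm0 : (0 : ℝ) ≤ max 1 C00 := le_max_of_le_left zero_le_one
  have hκ'2 : 0 ≤ (κ / 2 - δ / 2 * ((D : ℝ) ^ 2 * Real.sqrt d)) / 2 := by linarith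
  obtain ⟨hSw0, hSwle⟩ := sum_adm_geom_nonneg_le hκ'2 s D d
  obtain ⟨hSwD0, -⟩ := sum_adm_geom_nonneg_le hκ'2 D D d
  obtain ⟨hS10, hS1le⟩ := sum_adm_geom_nonneg_le hκ' s D d
  obtain ⟨hS1D0, -⟩ := sum_adm_geom_nonneg_le hκ' D D d
  set Sws := ∑ p ∈ Finset.Icc 1 s, ((admissible p D).card : ℝ) * ((2 / (1 - Real.exp (-((κ / 2 - δ / 2 * ((D : ℝ) ^ 2 * Real.sqrt d)) / 2 / (p : ℕ) / Real.sqrt d))) * Real.exp ((κ / 2 - δ / 2 * ((D : ℝ) ^ 2 * Real.sqrt d)) / 2 / (p : ℕ) / Real.sqrt d)) ^ d) ^ (p - 1) with hSws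
  set SwD := ∑ p ∈ Finset.Icc 1 D, ((admissible p D).card : ℝ) * ((2 / (1 - Real.exp (-((κ / 2 - δ / 2 * ((D : ℝ) ^ 2 * Real.sqrt d)) / 2 / (p : ℕ) / Real.sqrt d))) * Real.exp ((κ / 2 - δ / 2 * ((D : ℝ) ^ 2 * Real.sqrt d)) / 2 / (p : ℕ) / Real.sqrt d)) ^ d) ^ (p - 1) with hSwD
  clear_value Sws SwD
  set S1s := ∑ p ∈ Finset.Icc 1 s, ((admissible p D).card : ℝ) * ((2 / (1 - Real.exp (-((κ / 2 - δ / 2 * ((D : ℝ) ^ 2 * Real.sqrt d)) / (p : ℕ) / Real.sqrt d))) * Real.exp ((κ / 2 - δ / 2 * ((D : ℝ) ^ 2 * Real.sqrt d)) / (p : ℕ) / Real.sqrt d)) ^ d) ^ (p - 1) with hS1s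
  set S1D := ∑ p ∈ Finset.Icc 1 D, ((admissible p D).card : ℝ) * ((2 / (1 - Real.exp (-((κ / 2 - δ / 2 * ((D : ℝ) ^ 2 * Real.sqrt d)) / (p : ℕ) / Real.sqrt d))) * Real.exp ((κ / 2 - δ / 2 * ((D : ℝ) ^ 2 * Real.sqrt d)) / (p : ℕ) / Real.sqrt d)) ^ d) ^ (p - 1) with hS1D
  clear_value S1s S1D
  set Φ : ℝ := 2 ^ ((k + 1) * D) * 2 ^ 2 ^ ((k + 1) * D) * (max 1 C00) ^ ((k + 1) * D) with hΦ
  have hΦ0 : 0 ≤ Φ := by rw [hΦ]; positivity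
  clear_value Φ
  set E : ℝ := Real.exp (δ / 2 * ((D : ℝ) ^ 2 * d)) with hE
  have hE0 : 0 ≤ E := by rw [hE]; exact (Real.exp_pos _).le
  clear_value E
  set g : ℝ := (2 / (1 - Real.exp (-(δ / (2 * ((k + 1 : ℕ) : ℝ)) / Real.sqrt d))) * Real.exp (δ / (2 * ((k + 1 : ℕ) : ℝ)) / Real.sqrt d)) ^ d with hg
  have hg0 : 0 ≤ g := by rw [hg]; exact pow_nonneg (geom_nonneg' (by positivity)) d
  clear_value g
  have hLd := side_pow_le hL d
  have hLd0 : 0 ≤ ((L : ℕ) : ℝ) ^ d := by positivity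
  have hc0 : 0 ≤ (κ / 2 - δ / 2 * ((D : ℝ) ^ 2 * Real.sqrt d)) / 2 := hκ'2
  have hX0 : (0 : ℝ) ≤ (w : ℝ) := Nat.cast_nonneg w
  have h1 : (A * E * g * S1s) ^ k ≤ (A * E * g * S1D) ^ k := pow_le_pow_left₀ (by positivity) (by gcongr) k
  have hNle' : N ≤ nI * (2 ^ d * b ^ (2 * d)) := hNle.trans (mul_le_mul_of_nonneg_left hLd hnI)
  have hnI' : 0 ≤ nI := hnI
  have hkey : (2 ^ (k + 1) * (Φ)) * (A * E * Real.exp (-((κ / 2 - δ / 2 * ((D : ℝ) ^ 2 * Real.sqrt d)) / 2 * w)) * N * Sws) * (A * E * g * S1s) ^ k ≤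
      ((2 ^ (k + 1) * (Φ) * (E * 2 ^ d * SwD) * (E * g * S1D) ^ k) * b ^ (2 * d) * A ^ (k + 1) * Real.exp (-((κ / 2 - δ / 2 * ((D : ℝ) ^ 2 * Real.sqrt d)) / 2 * ((w : ℝ))))) * nI := by
    calc (2 ^ (k + 1) * (Φ)) * (A * E * Real.exp (-((κ / 2 - δ / 2 * ((D : ℝ) ^ 2 * Real.sqrt d)) / 2 * w)) * N * Sws) * (A * E * g * S1s) ^ k
        ≤ (2 ^ (k + 1) * Φ) * (A * E * Real.exp (-((κ / 2 - δ / 2 * ((D : ℝ) ^ 2 * Real.sqrt d)) / 2 * w)) * (nI * (2 ^ d * b ^ (2 * d))) * SwD) * (A * E * g * S1D) ^ k := by gcongr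
      _ = _ := by ring
  have hatom := decay_atom_le_snd (A := A) (b := b) (b₀ := b₀) (ρ₃ := ρ₃) (ρ₄ := ρ₄)
    (C := 2 ^ (k + 1) * (Φ) * (E * 2 ^ d * SwD) * (E * g * S1D) ^ k) (c := (κ / 2 - δ / 2 * ((D : ℝ) ^ 2 * Real.sqrt d)) / 2) (X := (w : ℝ)) (M := M)
    (by positivity) hA hb hb₀ hρ₃ hρ₄ hc0 hX0 hreg hM (2 * d) (k + 1)
  have hS0' : 0 ≤ (2 ^ (k + 1) * (Φ) * (E * 2 ^ d * SwD) * (E * g * S1D) ^ k) * (k + 1).factorial * ((2 * d).factorial + b₀ ^ (2 * d) * Real.exp (ρ₃ * b₀ ^ (3 / 2 : ℝ))) := by positivity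
  have hS0 : 0 ≤ (2 ^ (k + 1) * (Φ) * (E * 2 ^ d * SwD) * (E * g * S1D) ^ k) * (k + 1).factorial * ((2 * d).factorial + b₀ ^ (2 * d) * Real.exp (ρ₃ * b₀ ^ (3 / 2 : ℝ))) * (Real.exp (-(ρ₃ * b ^ (3 / 2 : ℝ))) * Real.exp (ρ₄ * A * b ^ ρ₃)) := by positivity
  have hfin := le_errTerm_of_le_snd (ρ₁ := ρ₁) (ρ₂ := ρ₂) (t := t) (le_refl ((2 ^ (k + 1) * (Φ) * (E * 2 ^ d * SwD) * (E * g * S1D) ^ k) * (k + 1).factorial * ((2 * d).factorial + b₀ ^ (2 * d) * Real.exp (ρ₃ * b₀ ^ (3 / 2 : ℝ))) * (Real.exp (-(ρ₃ * b ^ (3 / 2 : ℝ))) * Real.exp (ρ₄ * A * b ^ ρ₃)))) hS0' hA hb0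
  calc (2 ^ (k + 1) * (Φ)) * (A * E * Real.exp (-((κ / 2 - δ / 2 * ((D : ℝ) ^ 2 * Real.sqrt d)) / 2 * w)) * N * Sws) * (A * E * g * S1s) ^ k
      ≤ ((2 ^ (k + 1) * (Φ) * (E * 2 ^ d * SwD) * (E * g * S1D) ^ k) * b ^ (2 * d) * A ^ (k + 1) * Real.exp (-((κ / 2 - δ / 2 * ((D : ℝ) ^ 2 * Real.sqrt d)) / 2 * ((w : ℝ))))) * nI := hkey
    _ ≤ ((2 ^ (k + 1) * (Φ) * (E * 2 ^ d * SwD) * (E * g * S1D) ^ k) * (k + 1).factorial * ((2 * d).factorial + b₀ ^ (2 * d) * Real.exp (ρ₃ * b₀ ^ (3 / 2 : ℝ))) * (Real.exp (-(ρ₃ * b ^ (3 / 2 : ℝ))) * Real.exp (ρ₄ * A * b ^ ρ₃))) * nI := mul_le_mul_of_nonneg_right hatom hnI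
    _ = nI * ((2 ^ (k + 1) * (Φ) * (E * 2 ^ d * SwD) * (E * g * S1D) ^ k) * (k + 1).factorial * ((2 * d).factorial + b₀ ^ (2 * d) * Real.exp (ρ₃ * b₀ ^ (3 / 2 : ℝ))) * (Real.exp (-(ρ₃ * b ^ (3 / 2 : ℝ))) * Real.exp (ρ₄ * A * b ^ ρ₃))) := by ring
    _ ≤ _ := mul_le_mul_of_nonneg_left hfin hnI'

set_option maxHeartbeats 400000 in -- long `calc`/closed-term elaboration (ops-buildfix 2026-08-27: keep ≥ 2× headroom)
/-- **ATOM (e) — the CROSS term `Φ·N·(k+1)k·(A·E·L^dg·Σ₁)·(A·E·e^{−(δ/(4(k+1)))(w+v+1)}·L^dg′·Σ₁)·(A·E·L^dg·Σ₁)^{k−1}` (print: `N = |B_k| ≤ |I|`;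
the sibling `abs_cross_le_closed` at the assembler's palette) fits the SECOND summand in both regimes** (rate `δ/(2(k+1))/2`, `X = w + v + 1`;
multiplicity `m = k − 1 + 2`, so no case split at `k = 0`): `≤ nI·(C·m!·((2dm)! + b₀^{2dm}e^{ρ₃b₀^{3/2}}))·e^{−ρ₃b^{3/2}}e^{ρ₄Ab^{ρ₃}}` given
`b₀ ≤ b → M·b^{3/2} ≤ v` and `ρ₃ + 1 ≤ (δ/(2(k+1))/2)·M`. [cite: BenfattoEtAl1978, (5.35) p.159, Appendix D p.165, (4.7) p.152] -/
theorem cum_e_le (hA : 0 ≤ A) (hb : 1 ≤ b) (hL : ((L : ℕ) : ℝ) ≤ 2 * b ^ 2) (hδ : 0 ≤ δ) (hκ' : 0 ≤ κ / 2 - δ / 2 * ((D : ℝ) ^ 2 * Real.sqrt d))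
    (hb₀ : 0 ≤ b₀) (hρ₃ : 0 ≤ ρ₃) (hρ₄ : 1 ≤ ρ₄) (hN0 : 0 ≤ N) (hNle : N ≤ nI) {k : ℕ}
    (hreg : b₀ ≤ b → M * b ^ (3 / 2 : ℝ) ≤ (v : ℝ)) (hM : ρ₃ + 1 ≤ δ / (2 * ((k + 1 : ℕ) : ℝ)) / 2 * M) :
    2 ^ ((k + 1) * D) * 2 ^ 2 ^ ((k + 1) * D) * (max 1 C00) ^ ((k + 1) * D) * (N * (((k + 1 : ℕ) : ℝ) * (k : ℝ) * ((A * Real.exp (δ / 2 * ((D : ℝ) ^ 2 * d)) * (((L : ℕ) : ℝ) ^ d * (2 / (1 - Real.exp (-(δ / (2 * ((k + 1 : ℕ) : ℝ)) / Real.sqrt d))) * Real.exp (δ / (2 * ((k + 1 : ℕ) : ℝ)) / Real.sqrt d)) ^ d) * ∑ p ∈ Finset.Icc 1 s, ((admissible p D).card : ℝ) * ((2 / (1 - Real.exp (-((κ / 2 - δ / 2 * ((D : ℝ) ^ 2 * Real.sqrt d)) / (p : ℕ) / Real.sqrt d))) * Real.exp ((κ / 2 - δ / 2 * ((D : ℝ)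 ^ 2 * Real.sqrt d)) / (p : ℕ) / Real.sqrt d)) ^ d) ^ (p - 1)) * ((A * Real.exp (δ / 2 * ((D : ℝ) ^ 2 * d)) * Real.exp (-(δ / (2 * ((k + 1 : ℕ) : ℝ)) / 2 * ((w : ℝ) + v + 1))) * (((L : ℕ) : ℝ) ^ d * (2 / (1 - Real.exp (-(δ / (2 * ((k + 1 : ℕ) : ℝ)) / 2 / Real.sqrt d))) * Real.exp (δ / (2 * ((k + 1 : ℕ) : ℝ)) / 2 / Real.sqrt d)) ^ d) * ∑ p ∈ Finset.Icc 1 s, ((admissible p D).card : ℝ) * ((2 / (1 - Real.exp (-((κ / 2 - δ / 2 * ((D : ℝ) ^ 2 * Real.sqrt d)) / (p : ℕ) / Real.sqrt d))) * Real.exp ((κ / 2 - δ / 2 * ((D : ℝ) ^ 2 * Real.sqrt d)) / (p : ℕ) / Real.sqrt d)) ^ d) ^ (p - 1)) * (A * Real.exp (δ / 2 * ((D : ℝ) ^ 2 * d)) * (((L : ℕ) : ℝ) ^ d * (2 / (1 - Real.exp (-(δ / (2 * ((k + 1 : ℕ) : ℝ)) / Real.sqrt d))) * Real.exp (δ / (2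 * ((k + 1 : ℕ) : ℝ)) / Real.sqrt d)) ^ d) * ∑ p ∈ Finset.Icc 1 s, ((admissible p D).card : ℝ) * ((2 / (1 - Real.exp (-((κ / 2 - δ / 2 * ((D : ℝ) ^ 2 * Real.sqrt d)) / (p : ℕ) / Real.sqrt d))) * Real.exp ((κ / 2 - δ / 2 * ((D : ℝ) ^ 2 * Real.sqrt d)) / (p : ℕ) / Real.sqrt d)) ^ d) ^ (p - 1)) ^ (k - 1))))) ≤
      nI * errTerm (((2 ^ ((k + 1) * D) * 2 ^ 2 ^ ((k + 1) * D) * (max 1 C00) ^ ((k + 1) * D)) * (((k + 1 : ℕ) : ℝ) * (k : ℝ)) * ((Real.exp (δ / 2 * ((D : ℝ) ^ 2 * d)) * (2 ^ d * (2 / (1 - Real.exp (-(δ / (2 * ((k + 1 : ℕ) : ℝ)) / Real.sqrt d))) * Real.exp (δ / (2 * ((k + 1 : ℕ) : ℝ)) / Real.sqrt d)) ^ d) * ∑ p ∈ Finset.Icc 1 D, ((admissible p D).card : ℝ) * ((2 / (1 - Real.exp (-((κ / 2 - δ / 2 * ((D : ℝ) ^ 2 * Real.sqrt d)) / (p : ℕ)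 / Real.sqrt d))) * Real.exp ((κ / 2 - δ / 2 * ((D : ℝ) ^ 2 * Real.sqrt d)) / (p : ℕ) / Real.sqrt d)) ^ d) ^ (p - 1)) * (Real.exp (δ / 2 * ((D : ℝ) ^ 2 * d)) * (2 ^ d * (2 / (1 - Real.exp (-(δ / (2 * ((k + 1 : ℕ) : ℝ)) / 2 / Real.sqrt d))) * Real.exp (δ / (2 * ((k + 1 : ℕ) : ℝ)) / 2 / Real.sqrt d)) ^ d) * ∑ p ∈ Finset.Icc 1 D, ((admissible p D).card : ℝ) * ((2 / (1 - Real.exp (-((κ / 2 - δ / 2 * ((D : ℝ) ^ 2 * Real.sqrt d)) / (p : ℕ) / Real.sqrt d))) * Real.exp ((κ / 2 - δ / 2 * ((D : ℝ) ^ 2 * Real.sqrt d)) / (p : ℕ) / Real.sqrt d)) ^ d) ^ (p - 1)) * (Real.exp (δ / 2 * ((D : ℝ) ^ 2 * d)) * (2 ^ d * (2 / (1 - Real.exp (-(δ / (2 * ((k + 1 : ℕ) : ℝ)) / Real.sqrt d))) * Real.exp (δ / (2 * ((k + 1 : ℕ) : ℝ)) / Real.sqrt d)) ^ d) * ∑ p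 ∈ Finset.Icc 1 D, ((admissible p D).card : ℝ) * ((2 / (1 - Real.exp (-((κ / 2 - δ / 2 * ((D : ℝ) ^ 2 * Real.sqrt d)) / (p : ℕ) / Real.sqrt d))) * Real.exp ((κ / 2 - δ / 2 * ((D : ℝ) ^ 2 * Real.sqrt d)) / (p : ℕ) / Real.sqrt d)) ^ d) ^ (p - 1)) ^ (k - 1))) * (k - 1 + 2).factorial * ((2 * d * (k - 1 + 2)).factorial + b₀ ^ (2 * d * (k - 1 + 2)) * Real.exp (ρ₃ * b₀ ^ (3 / 2 : ℝ)))) ρ₁ ρ₂ ρ₃ ρ₄ A b t := by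
  have hb0 : 0 ≤ b := zero_le_one.trans hb
  have hm0 : (0 : ℝ) ≤ max 1 C00 := le_max_of_le_left zero_le_one
  have hκ'2 : 0 ≤ (κ / 2 - δ / 2 * ((D : ℝ) ^ 2 * Real.sqrt d)) / 2 := by linarith
  obtain ⟨hSw0, hSwle⟩ := sum_adm_geom_nonneg_le hκ'2 s D d
  obtain ⟨hSwD0, -⟩ := sum_adm_geom_nonneg_le hκ'2 D D d
  obtain ⟨hS10, hS1le⟩ := sum_adm_geom_nonneg_le hκ' s D d
  obtain ⟨hS1D0, -⟩ := sum_adm_geom_nonneg_le hκ' D D d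
  set Sws := ∑ p ∈ Finset.Icc 1 s, ((admissible p D).card : ℝ) * ((2 / (1 - Real.exp (-((κ / 2 - δ / 2 * ((D : ℝ) ^ 2 * Real.sqrt d)) / 2 / (p : ℕ) / Real.sqrt d))) * Real.exp ((κ / 2 - δ / 2 * ((D : ℝ) ^ 2 * Real.sqrt d)) / 2 / (p : ℕ) / Real.sqrt d)) ^ d) ^ (p - 1) with hSws
  set SwD := ∑ p ∈ Finset.Icc 1 D, ((admissible p D).card : ℝ) * ((2 / (1 - Real.exp (-((κ / 2 - δ / 2 * ((D : ℝ) ^ 2 * Real.sqrt d)) / 2 / (p : ℕ) / Real.sqrt d))) * Real.exp ((κ / 2 - δ / 2 * ((D : ℝ) ^ 2 * Real.sqrt d)) / 2 / (p : ℕ) / Real.sqrt d)) ^ d) ^ (p - 1) with hSwD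
  clear_value Sws SwD
  set S1s := ∑ p ∈ Finset.Icc 1 s, ((admissible p D).card : ℝ) * ((2 / (1 - Real.exp (-((κ / 2 - δ / 2 * ((D : ℝ) ^ 2 * Real.sqrt d)) / (p : ℕ) / Real.sqrt d))) * Real.exp ((κ / 2 - δ / 2 * ((D : ℝ) ^ 2 * Real.sqrt d)) / (p : ℕ) / Real.sqrt d)) ^ d) ^ (p - 1) with hS1s
  set S1D := ∑ p ∈ Finset.Icc 1 D, ((admissible p D).card : ℝ) * ((2 / (1 - Real.exp (-((κ / 2 - δ / 2 * ((D : ℝ) ^ 2 * Real.sqrt d)) / (p : ℕ) / Real.sqrt d))) * Real.exp ((κ / 2 - δ / 2 * ((D : ℝ) ^ 2 * Real.sqrt d)) / (p : ℕ) / Real.sqrt d)) ^ d) ^ (p - 1) with hS1D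
  clear_value S1s S1D
  set Φ : ℝ := 2 ^ ((k + 1) * D) * 2 ^ 2 ^ ((k + 1) * D) * (max 1 C00) ^ ((k + 1) * D) with hΦ
  have hΦ0 : 0 ≤ Φ := by rw [hΦ]; positivity
  clear_value Φ
  set E : ℝ := Real.exp (δ / 2 * ((D : ℝ) ^ 2 * d)) with hE
  have hE0 : 0 ≤ E := by rw [hE]; exact (Real.exp_pos _).le
  clear_value E
  set g : ℝ := (2 / (1 - Real.exp (-(δ / (2 * ((k + 1 : ℕ) : ℝ)) / Real.sqrt d))) * Real.exp (δ / (2 * ((k + 1 : ℕ) : ℝ)) / Real.sqrt d)) ^ d with hg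
  have hg0 : 0 ≤ g := by rw [hg]; exact pow_nonneg (geom_nonneg' (by positivity)) d
  clear_value g
  have hLd := side_pow_le hL d
  have hLd0 : 0 ≤ ((L : ℕ) : ℝ) ^ d := by positivity
  set g' : ℝ := (2 / (1 - Real.exp (-(δ / (2 * ((k + 1 : ℕ) : ℝ)) / 2 / Real.sqrt d))) * Real.exp (δ / (2 * ((k + 1 : ℕ) : ℝ)) / 2 / Real.sqrt d)) ^ d with hg'
  have hg'0 : 0 ≤ g' := by rw [hg']; exact pow_nonneg (geom_nonneg' (by positivity)) d
  clear_value g'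
  have hc0 : 0 ≤ δ / (2 * ((k + 1 : ℕ) : ℝ)) / 2 := by positivity
  have hX0 : 0 ≤ (w : ℝ) + v + 1 := by positivity
  have hreg' : b₀ ≤ b → M * b ^ (3 / 2 : ℝ) ≤ (w : ℝ) + v + 1 := fun h => (hreg h).trans (by linarith [(Nat.cast_nonneg w : (0 : ℝ) ≤ w)])
  have hunit : A * E * (((L : ℕ) : ℝ) ^ d * g) * S1s ≤ A * E * (2 ^ d * b ^ (2 * d) * g) * S1D := by gcongr
  have hunit0 : 0 ≤ A * E * (((L : ℕ) : ℝ) ^ d * g) * S1s := by positivity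
  have hpow : (A * E * (((L : ℕ) : ℝ) ^ d * g) * S1s) ^ (k - 1) ≤ (A * E * (2 ^ d * b ^ (2 * d) * g) * S1D) ^ (k - 1) := pow_le_pow_left₀ hunit0 hunit _
  have hnI' : 0 ≤ nI := hN0.trans hNle
  have hkey : Φ * (N * (((k + 1 : ℕ) : ℝ) * (k : ℝ) * ((A * E * (((L : ℕ) : ℝ) ^ d * g) * S1s) * ((A * E * Real.exp (-(δ / (2 * ((k + 1 : ℕ) : ℝ)) / 2 * ((w : ℝ) + v + 1))) * (((L : ℕ) : ℝ) ^ d * g') * S1s) * (A * E * (((L : ℕ) : ℝ) ^ d * g) * S1s) ^ (k - 1))))) ≤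
      (((Φ) * (((k + 1 : ℕ) : ℝ) * (k : ℝ)) * ((E * (2 ^ d * g) * S1D) * (E * (2 ^ d * g') * S1D) * (E * (2 ^ d * g) * S1D) ^ (k - 1))) * b ^ (2 * d * (k - 1 + 2)) * A ^ (k - 1 + 2) * Real.exp (-(δ / (2 * ((k + 1 : ℕ) : ℝ)) / 2 * ((w : ℝ) + v + 1)))) * N := by
    calc Φ * (N * (((k + 1 : ℕ) : ℝ) * (k : ℝ) * ((A * E * (((L : ℕ) : ℝ) ^ d * g) * S1s) * ((A * E * Real.exp (-(δ / (2 * ((k + 1 : ℕ) : ℝ)) / 2 * ((w : ℝ) + v + 1))) * (((L : ℕ) : ℝ) ^ d * g') * S1s) * (A * E * (((L : ℕ) : ℝ) ^ d * g) * S1s) ^ (k - 1)))))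
        ≤ Φ * (N * (((k + 1 : ℕ) : ℝ) * (k : ℝ) * ((A * E * (2 ^ d * b ^ (2 * d) * g) * S1D) * ((A * E * Real.exp (-(δ / (2 * ((k + 1 : ℕ) : ℝ)) / 2 * ((w : ℝ) + v + 1))) * (2 ^ d * b ^ (2 * d) * g') * S1D) * (A * E * (2 ^ d * b ^ (2 * d) * g) * S1D) ^ (k - 1))))) := by gcongr
      _ = _ := by ring
  have hatom := decay_atom_le_snd (A := A) (b := b) (b₀ := b₀) (ρ₃ := ρ₃) (ρ₄ := ρ₄)
    (C := (Φ) * (((k + 1 : ℕ) : ℝ) * (k : ℝ)) * ((E * (2 ^ d * g) * S1D) * (E * (2 ^ d * g') * S1D) * (E * (2 ^ d * g) * S1D) ^ (k - 1))) (c := δ / (2 * ((k + 1 : ℕ) : ℝ)) / 2) (X := (w : ℝ) + v + 1) (M := M)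
    (by positivity) hA hb hb₀ hρ₃ hρ₄ hc0 hX0 hreg' hM (2 * d * (k - 1 + 2)) (k - 1 + 2)
  have hS0' : 0 ≤ ((Φ) * (((k + 1 : ℕ) : ℝ) * (k : ℝ)) * ((E * (2 ^ d * g) * S1D) * (E * (2 ^ d * g') * S1D) * (E * (2 ^ d * g) * S1D) ^ (k - 1))) * (k - 1 + 2).factorial * ((2 * d * (k - 1 + 2)).factorial + b₀ ^ (2 * d * (k - 1 + 2)) * Real.exp (ρ₃ * b₀ ^ (3 / 2 : ℝ))) := by positivity
  have hS0 : 0 ≤ ((Φ) * (((k + 1 : ℕ) : ℝ) * (k : ℝ)) * ((E * (2 ^ d * g) * S1D) * (E * (2 ^ d * g') * S1D) * (E * (2 ^ d * g) * S1D) ^ (k - 1))) * (k - 1 + 2).factorial * ((2 * d * (k - 1 + 2)).factorial + b₀ ^ (2 * d * (k - 1 + 2)) * Real.exp (ρ₃ * b₀ ^ (3 / 2 : ℝ))) * (Real.exp (-(ρ₃ * b ^ (3 / 2 : ℝ))) * Real.exp (ρ₄ * A * b ^ ρ₃)) := by positivity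
  have hfin := le_errTerm_of_le_snd (ρ₁ := ρ₁) (ρ₂ := ρ₂) (t := t) (le_refl (((Φ) * (((k + 1 : ℕ) : ℝ) * (k : ℝ)) * ((E * (2 ^ d * g) * S1D) * (E * (2 ^ d * g') * S1D) * (E * (2 ^ d * g) * S1D) ^ (k - 1))) * (k - 1 + 2).factorial * ((2 * d * (k - 1 + 2)).factorial + b₀ ^ (2 * d * (k - 1 + 2)) * Real.exp (ρ₃ * b₀ ^ (3 / 2 : ℝ))) * (Real.exp (-(ρ₃ * b ^ (3 / 2 : ℝ))) * Real.exp (ρ₄ * A * b ^ ρ₃)))) hS0' hA hb0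
  calc Φ * (N * (((k + 1 : ℕ) : ℝ) * (k : ℝ) * ((A * E * (((L : ℕ) : ℝ) ^ d * g) * S1s) * ((A * E * Real.exp (-(δ / (2 * ((k + 1 : ℕ) : ℝ)) / 2 * ((w : ℝ) + v + 1))) * (((L : ℕ) : ℝ) ^ d * g') * S1s) * (A * E * (((L : ℕ) : ℝ) ^ d * g) * S1s) ^ (k - 1)))))
      ≤ (((Φ) * (((k + 1 : ℕ) : ℝ) * (k : ℝ)) * ((E * (2 ^ d * g) * S1D) * (E * (2 ^ d * g') * S1D) * (E * (2 ^ d * g) * S1D) ^ (k - 1))) * b ^ (2 * d * (k - 1 + 2)) * A ^ (k - 1 + 2) * Real.exp (-(δ / (2 * ((k + 1 : ℕ) : ℝ)) / 2 * ((w : ℝ) + v + 1)))) * N := hkey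
    _ ≤ (((Φ) * (((k + 1 : ℕ) : ℝ) * (k : ℝ)) * ((E * (2 ^ d * g) * S1D) * (E * (2 ^ d * g') * S1D) * (E * (2 ^ d * g) * S1D) ^ (k - 1))) * (k - 1 + 2).factorial * ((2 * d * (k - 1 + 2)).factorial + b₀ ^ (2 * d * (k - 1 + 2)) * Real.exp (ρ₃ * b₀ ^ (3 / 2 : ℝ))) * (Real.exp (-(ρ₃ * b ^ (3 / 2 : ℝ))) * Real.exp (ρ₄ * A * b ^ ρ₃))) * nI := mul_le_mul hatom hNle hN0 hS0
    _ = nI * (((Φ) * (((k + 1 : ℕ) : ℝ) * (k : ℝ)) * ((E * (2 ^ d * g) * S1D) * (E * (2 ^ d * g') * S1D) * (E * (2 ^ d * g) * S1D) ^ (k - 1))) * (k - 1 + 2).factorial * ((2 * d * (k - 1 + 2)).factorial + b₀ ^ (2 * d * (k - 1 + 2)) * Real.exp (ρ₃ * b₀ ^ (3 / 2 : ℝ))) * (Real.exp (-(ρ₃ * b ^ (3 / 2 : ℝ))) * Real.exp (ρ₄ * A * b ^ ρ₃))) := by ring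
    _ ≤ _ := mul_le_mul_of_nonneg_left hfin hnI'

set_option maxHeartbeats 400000 in -- long `calc`/closed-term elaboration (ops-buildfix 2026-08-27: keep ≥ 2× headroom)
/-- **ATOM (f) — the within-box term `W₂₉`: `N·3^{k+1}·Φ·e^{−(δ/2)(v+1)}·(A·E·L^d·Σ₁)^{k+1}` (print: `N = |B_k| ≤ |I|`) fits the SECOND summand in
both regimes** (rate `δ/2`, `X = v + 1`): `≤ nI·(C·(k+1)!·((2d(k+1))! + b₀^{2d(k+1)}e^{ρ₃b₀^{3/2}}))·e^{−ρ₃b^{3/2}}e^{ρ₄Ab^{ρ₃}}`.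
[cite: BenfattoEtAl1978, (5.29) p.157, (5.35) p.159, Appendix D p.165, (4.7) p.152] -/
theorem cum_f_le (hA : 0 ≤ A) (hb : 1 ≤ b) (hL : ((L : ℕ) : ℝ) ≤ 2 * b ^ 2) (hδ : 0 ≤ δ) (hκ' : 0 ≤ κ / 2 - δ / 2 * ((D : ℝ) ^ 2 * Real.sqrt d))
    (hb₀ : 0 ≤ b₀) (hρ₃ : 0 ≤ ρ₃) (hρ₄ : 1 ≤ ρ₄) (hN0 : 0 ≤ N) (hNle : N ≤ nI)
    (hreg : b₀ ≤ b → M * b ^ (3 / 2 : ℝ) ≤ (v : ℝ)) (hM : ρ₃ + 1 ≤ δ / 2 * M) (k : ℕ) :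
    N * ((3 : ℝ) ^ (k + 1) * (2 ^ ((k + 1) * D) * 2 ^ 2 ^ ((k + 1) * D) * (max 1 C00) ^ ((k + 1) * D) * Real.exp (-(δ / 2 * ((v : ℝ) + 1))) * (A * Real.exp (δ / 2 * ((D : ℝ) ^ 2 * d)) * ((L : ℕ) : ℝ) ^ d * ∑ p ∈ Finset.Icc 1 s, ((admissible p D).card : ℝ) * ((2 / (1 - Real.exp (-((κ / 2 - δ / 2 * ((D : ℝ) ^ 2 * Real.sqrt d)) / (p : ℕ) / Real.sqrt d))) * Real.exp ((κ / 2 - δ / 2 * ((D : ℝ) ^ 2 * Real.sqrt d)) / (p : ℕ) / Real.sqrt d)) ^ d) ^ (p - 1)) ^ (k + 1))) ≤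
      nI * errTerm (((3 : ℝ) ^ (k + 1) * (2 ^ ((k + 1) * D) * 2 ^ 2 ^ ((k + 1) * D) * (max 1 C00) ^ ((k + 1) * D)) * (Real.exp (δ / 2 * ((D : ℝ) ^ 2 * d)) * 2 ^ d * ∑ p ∈ Finset.Icc 1 D, ((admissible p D).card : ℝ) * ((2 / (1 - Real.exp (-((κ / 2 - δ / 2 * ((D : ℝ) ^ 2 * Real.sqrt d)) / (p : ℕ) / Real.sqrt d))) * Real.exp ((κ / 2 - δ / 2 * ((D : ℝ) ^ 2 * Real.sqrt d)) / (p : ℕ) / Real.sqrt d)) ^ d) ^ (p - 1)) ^ (k + 1)) * (k + 1).factorial * ((2 * d * (k + 1)).factorial + b₀ ^ (2 * d * (k + 1)) * Real.exp (ρ₃ * b₀ ^ (3 / 2 : ℝ)))) ρ₁ ρ₂ ρ₃ ρ₄ A b t := by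
  have hb0 : 0 ≤ b := zero_le_one.trans hb
  have hm0 : (0 : ℝ) ≤ max 1 C00 := le_max_of_le_left zero_le_one
  have hκ'2 : 0 ≤ (κ / 2 - δ / 2 * ((D : ℝ) ^ 2 * Real.sqrt d)) / 2 := by linarith
  obtain ⟨hSw0, hSwle⟩ := sum_adm_geom_nonneg_le hκ'2 s D d
  obtain ⟨hSwD0, -⟩ := sum_adm_geom_nonneg_le hκ'2 D D d
  obtain ⟨hS10, hS1le⟩ := sum_adm_geom_nonneg_le hκ' s D d
  obtain ⟨hS1D0, -⟩ := sum_adm_geom_nonneg_le hκ' D D d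
  set Sws := ∑ p ∈ Finset.Icc 1 s, ((admissible p D).card : ℝ) * ((2 / (1 - Real.exp (-((κ / 2 - δ / 2 * ((D : ℝ) ^ 2 * Real.sqrt d)) / 2 / (p : ℕ) / Real.sqrt d))) * Real.exp ((κ / 2 - δ / 2 * ((D : ℝ) ^ 2 * Real.sqrt d)) / 2 / (p : ℕ) / Real.sqrt d)) ^ d) ^ (p - 1) with hSws
  set SwD := ∑ p ∈ Finset.Icc 1 D, ((admissible p D).card : ℝ) * ((2 / (1 - Real.exp (-((κ / 2 - δ / 2 * ((D : ℝ) ^ 2 * Real.sqrt d)) / 2 / (p : ℕ) / Real.sqrt d))) * Real.exp ((κ / 2 - δ / 2 * ((D : ℝ) ^ 2 * Real.sqrt d)) / 2 / (p : ℕ) / Real.sqrt d)) ^ d) ^ (p - 1) with hSwD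
  clear_value Sws SwD
  set S1s := ∑ p ∈ Finset.Icc 1 s, ((admissible p D).card : ℝ) * ((2 / (1 - Real.exp (-((κ / 2 - δ / 2 * ((D : ℝ) ^ 2 * Real.sqrt d)) / (p : ℕ) / Real.sqrt d))) * Real.exp ((κ / 2 - δ / 2 * ((D : ℝ) ^ 2 * Real.sqrt d)) / (p : ℕ) / Real.sqrt d)) ^ d) ^ (p - 1) with hS1s
  set S1D := ∑ p ∈ Finset.Icc 1 D, ((admissible p D).card : ℝ) * ((2 / (1 - Real.exp (-((κ / 2 - δ / 2 * ((D : ℝ) ^ 2 * Real.sqrt d)) / (p : ℕ) / Real.sqrt d))) * Real.exp ((κ / 2 - δ / 2 * ((D : ℝ) ^ 2 * Real.sqrt d)) / (p : ℕ) / Real.sqrt d)) ^ d) ^ (p - 1) with hS1D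
  clear_value S1s S1D
  set Φ : ℝ := 2 ^ ((k + 1) * D) * 2 ^ 2 ^ ((k + 1) * D) * (max 1 C00) ^ ((k + 1) * D) with hΦ
  have hΦ0 : 0 ≤ Φ := by rw [hΦ]; positivity
  clear_value Φ
  set E : ℝ := Real.exp (δ / 2 * ((D : ℝ) ^ 2 * d)) with hE
  have hE0 : 0 ≤ E := by rw [hE]; exact (Real.exp_pos _).le
  clear_value E
  set g : ℝ := (2 / (1 - Real.exp (-(δ / (2 * ((k + 1 : ℕ) : ℝ)) / Real.sqrt d))) * Real.exp (δ / (2 * ((k + 1 : ℕ) : ℝ)) / Real.sqrt d)) ^ d with hg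
  have hg0 : 0 ≤ g := by rw [hg]; exact pow_nonneg (geom_nonneg' (by positivity)) d
  clear_value g
  have hLd := side_pow_le hL d
  have hLd0 : 0 ≤ ((L : ℕ) : ℝ) ^ d := by positivity
  have hc0 : 0 ≤ δ / 2 := by linarith
  have hX0 : 0 ≤ (v : ℝ) + 1 := by positivity
  have hreg' : b₀ ≤ b → M * b ^ (3 / 2 : ℝ) ≤ (v : ℝ) + 1 := fun h => (hreg h).trans (by linarith)
  have hunit : A * E * ((L : ℕ) : ℝ) ^ d * S1s ≤ A * E * (2 ^ d * b ^ (2 * d)) * S1D := by gcongr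
  have hunit0 : 0 ≤ A * E * ((L : ℕ) : ℝ) ^ d * S1s := by positivity
  have hpow : (A * E * ((L : ℕ) : ℝ) ^ d * S1s) ^ (k + 1) ≤ (A * E * (2 ^ d * b ^ (2 * d)) * S1D) ^ (k + 1) := pow_le_pow_left₀ hunit0 hunit _
  have hnI' : 0 ≤ nI := hN0.trans hNle
  have hkey : N * ((3 : ℝ) ^ (k + 1) * (Φ * Real.exp (-(δ / 2 * ((v : ℝ) + 1))) * (A * E * ((L : ℕ) : ℝ) ^ d * S1s) ^ (k + 1))) ≤
      (((3 : ℝ) ^ (k + 1) * (Φ) * (E * 2 ^ d * S1D) ^ (k + 1)) * b ^ (2 * d * (k + 1)) * A ^ (k + 1) * Real.exp (-(δ / 2 * ((v : ℝ) + 1)))) * N := by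
    calc N * ((3 : ℝ) ^ (k + 1) * (Φ * Real.exp (-(δ / 2 * ((v : ℝ) + 1))) * (A * E * ((L : ℕ) : ℝ) ^ d * S1s) ^ (k + 1)))
        ≤ N * ((3 : ℝ) ^ (k + 1) * (Φ * Real.exp (-(δ / 2 * ((v : ℝ) + 1))) * (A * E * (2 ^ d * b ^ (2 * d)) * S1D) ^ (k + 1))) := by gcongr
      _ = _ := by ring
  have hatom := decay_atom_le_snd (A := A) (b := b) (b₀ := b₀) (ρ₃ := ρ₃) (ρ₄ := ρ₄)
    (C := (3 : ℝ) ^ (k + 1) * (Φ) * (E * 2 ^ d * S1D) ^ (k + 1)) (c := δ / 2) (X := (v : ℝ) + 1) (M := M)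
    (by positivity) hA hb hb₀ hρ₃ hρ₄ hc0 hX0 hreg' hM (2 * d * (k + 1)) (k + 1)
  have hS0' : 0 ≤ ((3 : ℝ) ^ (k + 1) * (Φ) * (E * 2 ^ d * S1D) ^ (k + 1)) * (k + 1).factorial * ((2 * d * (k + 1)).factorial + b₀ ^ (2 * d * (k + 1)) * Real.exp (ρ₃ * b₀ ^ (3 / 2 : ℝ))) := by positivity
  have hS0 : 0 ≤ ((3 : ℝ) ^ (k + 1) * (Φ) * (E * 2 ^ d * S1D) ^ (k + 1)) * (k + 1).factorial * ((2 * d * (k + 1)).factorial + b₀ ^ (2 * d * (k + 1)) * Real.exp (ρ₃ * b₀ ^ (3 / 2 : ℝ))) * (Real.exp (-(ρ₃ * b ^ (3 / 2 : ℝ))) * Real.exp (ρ₄ * A * b ^ ρ₃)) := by positivity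
  have hfin := le_errTerm_of_le_snd (ρ₁ := ρ₁) (ρ₂ := ρ₂) (t := t) (le_refl (((3 : ℝ) ^ (k + 1) * (Φ) * (E * 2 ^ d * S1D) ^ (k + 1)) * (k + 1).factorial * ((2 * d * (k + 1)).factorial + b₀ ^ (2 * d * (k + 1)) * Real.exp (ρ₃ * b₀ ^ (3 / 2 : ℝ))) * (Real.exp (-(ρ₃ * b ^ (3 / 2 : ℝ))) * Real.exp (ρ₄ * A * b ^ ρ₃)))) hS0' hA hb0
  calc N * ((3 : ℝ) ^ (k + 1) * (Φ * Real.exp (-(δ / 2 * ((v : ℝ) + 1))) * (A * E * ((L : ℕ) : ℝ) ^ d * S1s) ^ (k + 1)))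
      ≤ (((3 : ℝ) ^ (k + 1) * (Φ) * (E * 2 ^ d * S1D) ^ (k + 1)) * b ^ (2 * d * (k + 1)) * A ^ (k + 1) * Real.exp (-(δ / 2 * ((v : ℝ) + 1)))) * N := hkey
    _ ≤ (((3 : ℝ) ^ (k + 1) * (Φ) * (E * 2 ^ d * S1D) ^ (k + 1)) * (k + 1).factorial * ((2 * d * (k + 1)).factorial + b₀ ^ (2 * d * (k + 1)) * Real.exp (ρ₃ * b₀ ^ (3 / 2 : ℝ))) * (Real.exp (-(ρ₃ * b ^ (3 / 2 : ℝ))) * Real.exp (ρ₄ * A * b ^ ρ₃))) * nI := mul_le_mul hatom hNle hN0 hS0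
    _ = nI * (((3 : ℝ) ^ (k + 1) * (Φ) * (E * 2 ^ d * S1D) ^ (k + 1)) * (k + 1).factorial * ((2 * d * (k + 1)).factorial + b₀ ^ (2 * d * (k + 1)) * Real.exp (ρ₃ * b₀ ^ (3 / 2 : ℝ))) * (Real.exp (-(ρ₃ * b ^ (3 / 2 : ℝ))) * Real.exp (ρ₄ * A * b ^ ρ₃))) := by ring
    _ ≤ _ := mul_le_mul_of_nonneg_left hfin hnI'

end CumulantAtoms

/-! ## §6  The structural per-step errors `e₅₁₁`, `e₅₃₄` of `ineq47_of_chain` / `ineq46_of_chain`'s `hledger`, atom by atom -/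

section StructuralAtoms

variable {s D d t : ℕ} {κ A b c Γ ρ₁ ρ₂ ρ₃ ρ₄ b₀ M N N' nI : ℝ} {L w v : ℕ}

/-- **ATOM `e₅₁₁`: `s₁(s)·A·c^D·e^{−(ϰ/4)w}·N`** (print (5.11): `N = |J_k| ≤ |I|`, cut-off `0 ≤ c ≤ Γb`) fits the SECOND summand in both regimes (rate `ϰ/4`,
`X = w`): `≤ nI·((s₁(D)Γ^D)·1!·(D! + b₀^De^{ρ₃b₀^{3/2}}))·e^{−ρ₃b^{3/2}}e^{ρ₄Ab^{ρ₃}}`. [cite: BenfattoEtAl1978, (5.11) p.155, (4.7) p.152, p.159] -/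
theorem struct₁_le (hκ : 0 ≤ κ) (hA : 0 ≤ A) (hb : 1 ≤ b) (hΓ : 0 ≤ Γ) (hc : 0 ≤ c) (hcb : c ≤ Γ * b) (hb₀ : 0 ≤ b₀) (hρ₃ : 0 ≤ ρ₃) (hρ₄ : 1 ≤ ρ₄)
    (hN0 : 0 ≤ N) (hNle : N ≤ nI) (hreg : b₀ ≤ b → M * b ^ (3 / 2 : ℝ) ≤ (w : ℝ)) (hM : ρ₃ + 1 ≤ κ / 4 * M) :
    s1Const s D d κ * A * c ^ D * Real.exp (-(κ / 4 * w)) * N ≤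
      nI * errTerm ((s1Const D D d κ * Γ ^ D) * (1 : ℕ).factorial * ((D).factorial + b₀ ^ D * Real.exp (ρ₃ * b₀ ^ (3 / 2 : ℝ))))
        ρ₁ ρ₂ ρ₃ ρ₄ A b t := by
  have hb0 : 0 ≤ b := zero_le_one.trans hb
  have hnI : 0 ≤ nI := hN0.trans hNle
  have hs := s1Const_le s D d hκ
  have hs0 := s1Const_nonneg D D d hκ
  have hss0 := s1Const_nonneg s D d hκ
  have hcD := cutoff_pow_le hc hcb D
  have hkey : s1Const s D d κ * A * c ^ D * Real.exp (-(κ / 4 * w)) * N ≤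
      ((s1Const D D d κ * Γ ^ D) * b ^ D * A ^ 1 * Real.exp (-(κ / 4 * (w : ℝ)))) * N := by
    calc s1Const s D d κ * A * c ^ D * Real.exp (-(κ / 4 * w)) * N
        ≤ s1Const D D d κ * A * (Γ ^ D * b ^ D) * Real.exp (-(κ / 4 * w)) * N := by gcongr
      _ = _ := by ring
  have hatom := decay_atom_le_snd (A := A) (b := b) (b₀ := b₀) (ρ₃ := ρ₃) (ρ₄ := ρ₄) (C := s1Const D D d κ * Γ ^ D) (c := κ / 4) (X := (w : ℝ))
    (M := M) (by positivity) hA hb hb₀ hρ₃ hρ₄ (by linarith) (Nat.cast_nonneg w) hreg hM D 1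
  have hS0 : 0 ≤ (s1Const D D d κ * Γ ^ D) * (1 : ℕ).factorial * ((D).factorial + b₀ ^ D * Real.exp (ρ₃ * b₀ ^ (3 / 2 : ℝ))) *
      (Real.exp (-(ρ₃ * b ^ (3 / 2 : ℝ))) * Real.exp (ρ₄ * A * b ^ ρ₃)) := by positivity
  have hS0' : 0 ≤ (s1Const D D d κ * Γ ^ D) * (1 : ℕ).factorial * ((D).factorial + b₀ ^ D * Real.exp (ρ₃ * b₀ ^ (3 / 2 : ℝ))) := by positivity
  have hfin := le_errTerm_of_le_snd (ρ₁ := ρ₁) (ρ₂ := ρ₂) (t := t) (le_refl ((s1Const D D d κ * Γ ^ D) * (1 : ℕ).factorial *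
    ((D).factorial + b₀ ^ D * Real.exp (ρ₃ * b₀ ^ (3 / 2 : ℝ))) * (Real.exp (-(ρ₃ * b ^ (3 / 2 : ℝ))) * Real.exp (ρ₄ * A * b ^ ρ₃)))) hS0' hA hb0
  calc s1Const s D d κ * A * c ^ D * Real.exp (-(κ / 4 * w)) * N
      ≤ ((s1Const D D d κ * Γ ^ D) * b ^ D * A ^ 1 * Real.exp (-(κ / 4 * (w : ℝ)))) * N := hkey
    _ ≤ ((s1Const D D d κ * Γ ^ D) * (1 : ℕ).factorial * ((D).factorial + b₀ ^ D * Real.exp (ρ₃ * b₀ ^ (3 / 2 : ℝ))) *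
        (Real.exp (-(ρ₃ * b ^ (3 / 2 : ℝ))) * Real.exp (ρ₄ * A * b ^ ρ₃))) * nI := mul_le_mul hatom hNle hN0 hS0
    _ = nI * ((s1Const D D d κ * Γ ^ D) * (1 : ℕ).factorial * ((D).factorial + b₀ ^ D * Real.exp (ρ₃ * b₀ ^ (3 / 2 : ℝ))) *
        (Real.exp (-(ρ₃ * b ^ (3 / 2 : ℝ))) * Real.exp (ρ₄ * A * b ^ ρ₃))) := by ring
    _ ≤ _ := mul_le_mul_of_nonneg_left hfin hnI

set_option maxHeartbeats 400000 in -- long `calc`/closed-term elaboration (ops-buildfix 2026-08-27: keep ≥ 2× headroom)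
/-- **ATOM `e₅₃₄`: `s₁(s)·A·c^D·(e^{−(ϰ/4)w}·N + e^{−(ϰ/4)v}·(N′·L^d))`** (print (5.34): `N = |Γ̄₁(B_k)| ≤ |I|·L^d`, `N′ = |B_k| ≤ |I|`; `v ≤ w`; cut-off
`0 ≤ c ≤ Γb`, `L ≤ 2b²`) fits the SECOND summand in both regimes (rate `ϰ/4`, `X = v`):
`≤ nI·(2·(s₁(D)Γ^D2^d)·1!·((D+2d)! + b₀^{D+2d}e^{ρ₃b₀^{3/2}}))·e^{−ρ₃b^{3/2}}e^{ρ₄Ab^{ρ₃}}`. [cite: BenfattoEtAl1978, (5.34) p.159, (4.7) p.152] -/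
theorem struct₂_le (hκ : 0 ≤ κ) (hA : 0 ≤ A) (hb : 1 ≤ b) (hΓ : 0 ≤ Γ) (hc : 0 ≤ c) (hcb : c ≤ Γ * b) (hL : ((L : ℕ) : ℝ) ≤ 2 * b ^ 2)
    (hvw : v ≤ w) (hb₀ : 0 ≤ b₀) (hρ₃ : 0 ≤ ρ₃) (hρ₄ : 1 ≤ ρ₄) (hnI : 0 ≤ nI) (hN0 : 0 ≤ N) (hNle : N ≤ nI * ((L : ℕ) : ℝ) ^ d)
    (hN'0 : 0 ≤ N') (hN'le : N' ≤ nI) (hreg : b₀ ≤ b → M * b ^ (3 / 2 : ℝ) ≤ (v : ℝ)) (hM : ρ₃ + 1 ≤ κ / 4 * M) :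
    s1Const s D d κ * A * c ^ D * (Real.exp (-(κ / 4 * w)) * N + Real.exp (-(κ / 4 * v)) * (N' * ((L : ℕ) : ℝ) ^ d)) ≤
      nI * errTerm (2 * (s1Const D D d κ * Γ ^ D * 2 ^ d) * (1 : ℕ).factorial * ((D + 2 * d).factorial + b₀ ^ (D + 2 * d) * Real.exp (ρ₃ * b₀ ^ (3 / 2 : ℝ))))
        ρ₁ ρ₂ ρ₃ ρ₄ A b t := by
  have hb0 : 0 ≤ b := zero_le_one.trans hb
  have hs := s1Const_le s D d hκ
  have hs0 := s1Const_nonneg D D d hκ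
  have hss0 := s1Const_nonneg s D d hκ
  have hcD := cutoff_pow_le hc hcb D
  have hLd := side_pow_le hL d
  have hLd0 : 0 ≤ ((L : ℕ) : ℝ) ^ d := by positivity
  -- both exponentials are `≤ e^{−(ϰ/4)v}` (`v ≤ w`)
  have hwv : Real.exp (-(κ / 4 * w)) ≤ Real.exp (-(κ / 4 * v)) := by
    rw [Real.exp_le_exp]
    have : (v : ℝ) ≤ w := by exact_mod_cast hvw
    nlinarith
  have hNb : N ≤ nI * (2 ^ d * b ^ (2 * d)) := hNle.trans (mul_le_mul_of_nonneg_left hLd hnI)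
  have hN'b : N' * ((L : ℕ) : ℝ) ^ d ≤ nI * (2 ^ d * b ^ (2 * d)) := mul_le_mul hN'le hLd hLd0 hnI
  have hkey : s1Const s D d κ * A * c ^ D * (Real.exp (-(κ / 4 * w)) * N + Real.exp (-(κ / 4 * v)) * (N' * ((L : ℕ) : ℝ) ^ d)) ≤
      ((2 * (s1Const D D d κ * Γ ^ D * 2 ^ d)) * b ^ (D + 2 * d) * A ^ 1 * Real.exp (-(κ / 4 * (v : ℝ)))) * nI := by
    calc s1Const s D d κ * A * c ^ D * (Real.exp (-(κ / 4 * w)) * N + Real.exp (-(κ / 4 * v)) * (N' * ((L : ℕ) : ℝ) ^ d))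
        ≤ s1Const D D d κ * A * (Γ ^ D * b ^ D) * (Real.exp (-(κ / 4 * v)) * (nI * (2 ^ d * b ^ (2 * d))) +
            Real.exp (-(κ / 4 * v)) * (nI * (2 ^ d * b ^ (2 * d)))) := by gcongr
      _ = _ := by ring
  have hatom := decay_atom_le_snd (A := A) (b := b) (b₀ := b₀) (ρ₃ := ρ₃) (ρ₄ := ρ₄) (C := 2 * (s1Const D D d κ * Γ ^ D * 2 ^ d)) (c := κ / 4)
    (X := (v : ℝ)) (M := M) (by positivity) hA hb hb₀ hρ₃ hρ₄ (by linarith) (Nat.cast_nonneg v) hreg hM (D + 2 * d) 1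
  have hS0' : 0 ≤ (2 * (s1Const D D d κ * Γ ^ D * 2 ^ d)) * (1 : ℕ).factorial * ((D + 2 * d).factorial + b₀ ^ (D + 2 * d) * Real.exp (ρ₃ * b₀ ^ (3 / 2 : ℝ))) := by
    positivity
  have hfin := le_errTerm_of_le_snd (ρ₁ := ρ₁) (ρ₂ := ρ₂) (t := t) (le_refl ((2 * (s1Const D D d κ * Γ ^ D * 2 ^ d)) * (1 : ℕ).factorial *
    ((D + 2 * d).factorial + b₀ ^ (D + 2 * d) * Real.exp (ρ₃ * b₀ ^ (3 / 2 : ℝ))) * (Real.exp (-(ρ₃ * b ^ (3 / 2 : ℝ))) * Real.exp (ρ₄ * A * b ^ ρ₃)))) hS0' hA hb0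
  calc s1Const s D d κ * A * c ^ D * (Real.exp (-(κ / 4 * w)) * N + Real.exp (-(κ / 4 * v)) * (N' * ((L : ℕ) : ℝ) ^ d))
      ≤ ((2 * (s1Const D D d κ * Γ ^ D * 2 ^ d)) * b ^ (D + 2 * d) * A ^ 1 * Real.exp (-(κ / 4 * (v : ℝ)))) * nI := hkey
    _ ≤ ((2 * (s1Const D D d κ * Γ ^ D * 2 ^ d)) * (1 : ℕ).factorial * ((D + 2 * d).factorial + b₀ ^ (D + 2 * d) * Real.exp (ρ₃ * b₀ ^ (3 / 2 : ℝ))) *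
        (Real.exp (-(ρ₃ * b ^ (3 / 2 : ℝ))) * Real.exp (ρ₄ * A * b ^ ρ₃))) * nI := mul_le_mul_of_nonneg_right hatom hnI
    _ = nI * ((2 * (s1Const D D d κ * Γ ^ D * 2 ^ d)) * (1 : ℕ).factorial * ((D + 2 * d).factorial + b₀ ^ (D + 2 * d) * Real.exp (ρ₃ * b₀ ^ (3 / 2 : ℝ))) *
        (Real.exp (-(ρ₃ * b ^ (3 / 2 : ℝ))) * Real.exp (ρ₄ * A * b ^ ρ₃))) := by ring
    _ ≤ _ := mul_le_mul_of_nonneg_left hfin hnI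

end StructuralAtoms

end Literature.MathematicalPhysics.QuantumFieldTheory.Balaban1983to89.B1Eq324BenfattoSect5LedgerDischargeCumulant

end
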